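import Literature.AnabelianGeometry.EtaleTheta.Discharge.Sec1CuspRationalOfR2
import Literature.AnabelianGeometry.EtaleTheta.SettingBridgeOfCuspLaws
import Literature.AnabelianGeometry.SemiGraphs.TemperedDeltaCompletion
import HarnessLib

/-!
# [EtTh] §1: at `IsThm16Origin` the once-punctured parameter bundle `OncePuncturedData` has NO independent content
# beyond {group-level datum, a cusp, the guard} — (P1) from the group-level datum, (P3) from compactness of `D_x`,
# (P4) from R2 (the cusp is `K`-rational)

Mochizuki, *The étale theta function and its Frobenioid-theoretic manifestations*, Publ. RIMS **45** (2009) [EtTh],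
§1 pp. 11–13 («a once-punctured elliptic curve», «any decomposition group of a cusp of `Y^log` determines … a section
`G_K → (Π^tp_Y)^ell` … a Galois covering `Y_N → Y`») [cite: MochizukiEtTh2009, §1 p.13]; [SemiAnbd] §6 pp. 69–71
[cite: MochizukiSemiAnbd2006, §6 p.71].  abc-iut cell, layer L2, seat abc-iut-w5-d051 (gen 4; NV / §1-interface lane);
PROOF-ONLY sequel of `Sec1CuspRationalOfR2.lean` (p458429).

WHAT.  abc-iut-L2-t7's parameter bundle `ThetaSetting.OncePuncturedData` (`SettingBridge.lean`) extends the [SemiAnbd]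
§6 group-level datum `GroupLevelData` by five fields: (P1) `Ker(augHat) = Δ_X`, (P2) a cusp exists, (P3) `D_x ⊆ Π^tp_Y`,
(P4) `aug(D_x) = G_K`, (P5) the guard `IsEtThOrigin`.  Of these, (P1) is a theorem of the group-level datum
(abc-iut-w5-d139's `TemperedCurve.ker_augHat_eq_deltaHat`), (P3) too (abc-iut-L2-t7's
`decomp_le_ker_toZ_of_groupLevelData`: compact subgroups die in the discrete `Z`), and (P4) is a theorem of the origin
clause R2 + (P3) (abc-iut-w5-d051's `IsThm16Origin.map_aug_decomp_eq_GK`, p458429).  Hence: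

* **`ThetaSetting.IsThm16Origin.nonempty_oncePuncturedData_iff`** — at `IsThm16Origin`:
  `Nonempty OncePuncturedData ↔ Nonempty GroupLevelData ∧ (∃ x, IsCusp x) ∧ IsEtThOrigin`;
* `ThetaSetting.IsThm16Origin.nonempty_oncePuncturedData` — the (⇐) packaging;
* `ThetaSetting.IsThm16Origin.cusp_profile_of_groupLevelData` — at `IsThm16Origin` + group-level datum, every cusp `x`
  has `D_x ⊆ Π^tp_Y`, `aug(D_x) = G_K`, `D_x` compact, and `G_{K_N} ≤ aug(D_x)` for all `N` (no `CuspLaws` needed;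
  compare abc-iut-L2-t7's `CuspLaws.cusp_profile`).

Census reading: the bundle's constructor of record `OncePuncturedData.ofCuspLaws` (abc-iut-L2-t7) needs the cusp laws
for (P4); at an origin (`IsThm16Origin`) the cusp laws are NOT needed for the bundle at all.  PROOF-ONLY: no definition
(the bundle is built inside `Nonempty`), no instance, no named fact.  HONEST FRAMING: interface law over the frozen root;
`IsThm16Origin` is a hypothesis inhabited only at models; nothing of [EtTh]/[SemiAnbd] is asserted for genuine tempered
fundamental groups; no side is taken on [IUTchIII] Cor. 3.12; typed ≠ proved.
-/

noncomputable section

namespace Literature.AnabelianGeometry.EtaleTheta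

open Literature.AnabelianGeometry.SemiGraphs Thm16Sub
open scoped Pointwise

namespace ThetaSetting

variable {p : ℕ} [Fact p.Prime] {D : ThetaSetting p}

/-- **At `IsThm16Origin`, `OncePuncturedData` ⟸ {group-level datum, a cusp, the guard}**: (P1) from the group-level
datum, (P3) from the compactness of decomposition groups, (P4) from R2 (p458429). [cite: MochizukiEtTh2009, §1 p.13] -/
theorem IsThm16Origin.nonempty_oncePuncturedData (h16 : D.IsThm16Origin)
    (d : D.toTemperedCurve.GroupLevelData) (hcusp : ∃ x : D.Pt, D.IsCusp x) (hO : D.IsEtThOrigin) :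
    Nonempty D.OncePuncturedData :=
  ⟨{ toGroupLevelData := d
     ker_augHat := D.toTemperedCurve.ker_augHat_eq_deltaHat d
     exists_cusp := hcusp
     decomp_le_ker_toZ := fun x _ => D.decomp_le_ker_toZ_of_groupLevelData d x
     map_aug_decomp := fun x hx => h16.map_aug_decomp_eq_GK hx (D.decomp_le_GtpY_of_groupLevelData d x)
     origin := hO }⟩

/-- **At `IsThm16Origin` the bundle is inhabited iff its three law-free ingredients are**: the group-level datum,
a cusp, the guard. [cite: MochizukiEtTh2009, §1 p.13] -/
theorem IsThm16Origin.nonempty_oncePuncturedData_iff (h16 : D.IsThm16Origin) :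
    Nonempty D.OncePuncturedData ↔
      Nonempty D.toTemperedCurve.GroupLevelData ∧ (∃ x : D.Pt, D.IsCusp x) ∧ D.IsEtThOrigin := by
  constructor
  · rintro ⟨e⟩
    exact ⟨⟨e.toGroupLevelData⟩, e.exists_cusp, e.origin⟩
  · rintro ⟨⟨d⟩, hcusp, hO⟩
    exact h16.nonempty_oncePuncturedData d hcusp hO

/-- **Cusp profile at an origin without the cusp laws**: at `IsThm16Origin` + group-level datum, every cusp `x` has
`D_x ⊆ Π^tp_Y` ((P3)), `aug(D_x) = G_K` ((P4), the cusp is `K`-rational), `D_x` compact, and `G_{K_N} ≤ aug(D_x)` at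
every level. [cite: MochizukiEtTh2009, §1 p.13] -/
theorem IsThm16Origin.cusp_profile_of_groupLevelData (h16 : D.IsThm16Origin)
    (d : D.toTemperedCurve.GroupLevelData) {x : D.Pt} (hx : D.IsCusp x) :
    D.decomp x ≤ D.GtpY ∧ (D.decomp x).map D.aug.toMonoidHom = D.GK ∧
      IsCompact (D.decomp x : Set D.PiTemp) ∧ ∀ N : ℕ+, D.GKN N ≤ (D.decomp x).map D.aug.toMonoidHom :=
  ⟨D.decomp_le_GtpY_of_groupLevelData d x,
    h16.map_aug_decomp_eq_GK hx (D.decomp_le_GtpY_of_groupLevelData d x),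
    D.toTemperedCurve.decompCompact_of_groupLevelData d x,
    fun N => h16.GKN_le_map_aug N ⟨x, hx, 1, (one_smul _ _).symm⟩ (D.decomp_le_GtpY_of_groupLevelData d x)⟩

end ThetaSetting

end Literature.AnabelianGeometry.EtaleTheta

end
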